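import Summits.NavierStokesRegularity.NavierStokesRegularity.Theorems.EfficiencyFloorRigidExitOrbitwiseEarlyDeficit
import Summits.NavierStokesRegularity.NavierStokesRegularity.Theorems.EfficiencyFloorFloorOfEfficiencyDecay
import Summits.NavierStokesRegularity.NavierStokesRegularity.Theorems.EfficiencyFloorProductionEfficiencyDecayIntegrateEfficiency
import HarnessLib

/-!
# Route `EfficiencyFloor`, support `RigidExit` (stmt-NavierStokesRegularity-25513) on the `ProductionEfficiencyDecay` ladder
# (stmt-NavierStokesRegularity-22866): `RigidExit` ⟸ REFERENCE DEFICIT + ORBIT-UNIFORM SHADOWING, BY NAME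

Helper file (`--supports stmt-NavierStokesRegularity-22866`; line `efficiency_floor`). The landed typed residue of `RigidExit` is the
orbitwise uniform early deficit `hED` at `ν = 1` (`NearMaximiserBoundedAmplification.rigidExit_of_orbitwiseEarlyDeficit`, p838906; exact
by `…Converse`, p839492). With the REFERENCE FLOW through a maximiser now in the tree (`RigidExit.ReferenceFlow.*`, p839713/p839755/
p839781: Leray's local regular `H¹` flow `v` from `m`, its budget, continuity at `0⁺`, strong `Ḣ¹` attainment, window ceiling) and
the `H¹` robustness-of-regularity estimate in the tree (`Literature.Analysis.FluidPDE.classicalNS_robustness_of_regularity_R3`,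
RRS 2016 Thm 9.1, a priori form), `hED(m)` splits into TWO statements about ONE function `v` (meant: the reference flow from `m`):

* **(R-exit) reference deficit** — at the early instant `η·W_m` (`W_m = (64/(27c⋆⁴))·Z(m)⁻²`) the reference enstrophy has a STRICT
  cubic-law deficit: `Z(v(ηW_m))²·(1 − η + 4θ) ≤ Z(m)²` for some `θ > 0` (upper-bound form: no positivity of `Z(v ·)` needed).
  [= item (i) instant exit, re-run for Leray's flow from `m` instead of a flow of the blow-up class.]
* **(R-shadow) orbit-uniform shadowing with scale** — for every flow `u` of the route class at `ν = 1` whose slice `u(s)` is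
  `ε`-close (scale-free `Ḣ¹∩Ḣ²`) to SOME orbit point `l•R m(l•R⁻¹(·−a))`, with the window inside the lifespan, there is a scale
  `l > 0` with `l·Z(m) ≤ (1+κ)·Z(u s)` and `Z(u(s + ηW(s))) ≤ l·Z(v(ηW_m)) + κ·Z(u s)`.
  [= symmetry covariance of the class + RRS Thm 9.1 on `[δ, ηW]` + `δ → 0⁺` by `ReferenceFlow.tendsto_enstrophy_sub_nhdsGT`.]

This file proves, BY NAME:

* `window_lt` — along every flow of the route class (any `ν`), for the sharp constant and every `0 ≤ η < 1`, `s ∈ (0,T)`: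
  `s + η·W(s) < T` (rung zero of the cubic law integrated against `Z → ∞`: `Z(s)⁻² ≤ 2K(T − s)`), so (R-shadow) may assume it;
* `earlyDeficit_of_referenceShadowing` — for fixed `c⋆, m`: numbers `η, θ, κ, ε` with the explicit compatibility
  `((1+κ)/√(1−η+4θ) + κ)²·(1−η+2θ) ≤ 1` (always satisfiable for small `κ`), (R-exit) and (R-shadow) ⟹ the `hED` block of `m`
  with the triple `(η, θ, ε)` (pure algebra + `window_lt` + positivity of the class enstrophy);
* `rigidExit_of_referenceShadowing` — **`Theses.EfficiencyFloor.RigidExit`** from (R-exit)+(R-shadow) for every normalised maximiser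
  at `ν = 1`, via `rigidExit_of_orbitwiseEarlyDeficit`.

HONEST FRAMING: implications between OPEN statements about a HYPOTHETICAL blow-up; (R-exit), (R-shadow), `RigidExit`,
`NearMaximiserBoundedAmplification`, clause (a), `LerayFloorGap`, `ProductionEfficiencyDecay` (stmt-22866) and Navier–Stokes
regularity stay OPEN; no summit statement is proved. [folklore]
-/

-- the problem directory repeats the summit name (`NavierStokesRegularity/NavierStokesRegularity`)
set_option linter.dupNamespace false

noncomputable section

open Set Filter MeasureTheory Topology Function
open scoped InnerProductSpace RealInnerProductSpace ENNReal NNReal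
open Literature.Analysis.FluidPDE

namespace Summit.NavierStokesRegularity.NavierStokesRegularity.Theorems

namespace RigidExit

namespace ReferenceShadowing

open NearMaximiserBoundedAmplification

/-! ## §1 The window of a class flow lies inside its lifespan -/

/-- **`s + η·W(s) < T`** along every maximal classical Leray–Hopf rapidly-decaying-datum solution, for the sharp constant `c⋆`,
`0 ≤ η < 1`, `s ∈ (0,T)`, `W(s) = (64ν³/(27c⋆⁴))·Z(u s)⁻²`: rung zero `Z(s)⁻² ≤ 2K(T−s)` (`K = 27c⋆⁴/(128ν³)`, the cubic law integrated
against `Z → ∞` at `T`). [cite: LuDoering2008, eq. (6)] -/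
theorem window_lt {c : ℝ} (hsharp : (0 < c ∧ (∀ v : EuclideanSpace ℝ (Fin 3) → EuclideanSpace ℝ (Fin 3), (ContDiff ℝ (⊤ : ℕ∞) v ∧ Literature.Analysis.FluidPDE.VectorCalculus.IsDivFree v ∧ (∫⁻ x, ‖iteratedFDeriv ℝ 0 v x‖ₑ ^ 2 < ⊤) ∧ (∫⁻ x, ‖iteratedFDeriv ℝ 1 v x‖ₑ ^ 2 < ⊤) ∧ (∫⁻ x, ‖iteratedFDeriv ℝ 2 v x‖ₑ ^ 2 < ⊤)) → (∫ x, ⟪Literature.Analysis.FluidPDE.curl v x, fderiv ℝ v x (Literature.Analysis.FluidPDE.curl v x)⟫_ℝ) ≤ c * (∫ x, ‖Literature.Analysis.FluidPDE.curl v x‖ ^ 2) ^ (3 / 4 : ℝ) * (∫ x, Literature.Analysis.FluidPDE.frobeniusNormSq (fderiv ℝ (Literature.Analysis.FluidPDE.curl v) x)) ^ (3 / 4 : ℝ)) ∧ ∀ c' : ℝ, (∀ w : EuclideanSpace ℝ (Fin 3) → EuclideanSpace ℝ (Fin 3), (ContDiff ℝ (⊤ : ℕ∞) w ∧ Literature.Analysis.FluidPDE.VectorCalculus.IsDivFree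 w ∧ (∫⁻ x, ‖iteratedFDeriv ℝ 0 w x‖ₑ ^ 2 < ⊤) ∧ (∫⁻ x, ‖iteratedFDeriv ℝ 1 w x‖ₑ ^ 2 < ⊤) ∧ (∫⁻ x, ‖iteratedFDeriv ℝ 2 w x‖ₑ ^ 2 < ⊤)) → (∫ x, ⟪Literature.Analysis.FluidPDE.curl w x, fderiv ℝ w x (Literature.Analysis.FluidPDE.curl w x)⟫_ℝ) ≤ c' * (∫ x, ‖Literature.Analysis.FluidPDE.curl w x‖ ^ 2) ^ (3 / 4 : ℝ) * (∫ x, Literature.Analysis.FluidPDE.frobeniusNormSq (fderiv ℝ (Literature.Analysis.FluidPDE.curl w) x)) ^ (3 / 4 : ℝ)) → c ≤ c')) {ν T : ℝ} (hν : 0 < ν) (hT : 0 < T)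
    {u : ℝ → EuclideanSpace ℝ (Fin 3) → EuclideanSpace ℝ (Fin 3)} {p : ℝ → EuclideanSpace ℝ (Fin 3) → ℝ}
    (hmax : IsMaximalSmoothSolution ν 0 u p T) (hLH : IsLerayHopfOn T ν 0 (u 0) u) (hdec : HasRapidSpatialDecay (u 0))
    {s : ℝ} (hs : s ∈ Ioo 0 T) {η : ℝ} (hη0 : 0 ≤ η) (hη1 : η < 1) :
    s + η * (64 * ν ^ 3 / (27 * c ^ 4) * (∫ x, ‖curl (u s) x‖ ^ 2)⁻¹ ^ 2) < T := by
  obtain ⟨c₀, hsharp₀, hbud⟩ := efficiencyFloor_sharpLuDoeringBudget_proof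
  have hcc : c₀ = c := sharp_const_unique hsharp₀ hsharp
  have hc : 0 < c := hsharp.1
  obtain ⟨Zr, D, hZD⟩ := hbud ν T hν hT u p hmax hLH hdec
  set K : ℝ := 27 * c ^ 4 / (128 * ν ^ 3) with hK
  have hKpos : 0 < K := by positivity
  have hZof : ∀ τ ∈ Ioo 0 T, (∫ x, ‖curl (u τ) x‖ ^ 2) = Zr τ := fun τ hτ => ((hZD τ hτ).2.2.2.1).symm
  have hpos : ∀ τ ∈ Ioo 0 T, 0 < Zr τ := fun τ hτ => by
    have h1 := lintegral_curl_sq_pos hν hT hmax hLH hdec τ ⟨hτ.1.le, hτ.2⟩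
    rw [(hZD τ hτ).1] at h1
    exact ENNReal.ofReal_pos.1 h1
  -- rung zero on `[s, T)` and `Z → ∞`
  have hdecay : ∀ a b : ℝ, s ≤ a → a ≤ b → b < T → (Zr a)⁻¹ ^ 2 - (Zr b)⁻¹ ^ 2 ≤ 2 * K * (b - a) := by
    refine ProductionEfficiencyDecay.stub_integrateEfficiency Zr s T K (fun τ hτ => hpos τ ⟨hs.1.trans_le hτ.1, hτ.2⟩)
      (fun τ hτ => ?_)
    have hτI : τ ∈ Ioo 0 T := ⟨hs.1.trans_le hτ.1, hτ.2⟩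
    refine ⟨D τ, (hZD τ hτI).2.2.2.2.1, ?_⟩
    have h3 := (hZD τ hτI).2.2.2.2.2.2
    rw [hcc] at h3
    exact h3
  have hunb : ∀ a < T, ∀ N : ℝ, ∃ t ∈ Ioo a T, N ≤ Zr t := by
    intro a ha N
    have hev := (BlowupEnstrophyUnbounded.main hν hT hmax hLH hdec N).and (Ioo_mem_nhdsLT (show max a 0 < T from max_lt ha hT))
    obtain ⟨t, hNt, ht⟩ := hev.exists
    have htI : t ∈ Ioo 0 T := ⟨(le_max_right a 0).trans_lt ht.1, ht.2⟩
    refine ⟨t, ⟨(le_max_left a 0).trans_lt ht.1, ht.2⟩, ?_⟩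
    rw [(hZD t htI).1, ENNReal.ofReal_le_ofReal_iff (hZD t htI).2.1] at hNt
    exact hNt
  have hfl := FloorOfEfficiencyDecay.inv_sq_le (by positivity : (0 : ℝ) ≤ 2 * K) hdecay hunb ⟨le_rfl, hs.2⟩
  -- `W(s) = (2K)⁻¹ Z(s)⁻² ≤ T − s`
  rw [hZof s hs]
  have he : 64 * ν ^ 3 / (27 * c ^ 4) = (2 * K)⁻¹ := by rw [hK]; field_simp; norm_num
  rw [he]
  have hW : (2 * K)⁻¹ * (Zr s)⁻¹ ^ 2 ≤ T - s := by
    rw [inv_mul_le_iff₀ (by positivity)]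
    exact hfl
  have hTs : 0 < T - s := by linarith [hs.2]
  have hW0 : 0 ≤ (2 * K)⁻¹ * (Zr s)⁻¹ ^ 2 := by positivity
  nlinarith

/-! ## §2 Algebra of the transfer -/

/-- The transfer inequality: from `Zv²(1−η+4θ) ≤ Zm²`, `l·Zm ≤ (1+κ)·Zs`, `Zs' ≤ l·Zv + κ·Zs` and the compatibility
`((1+κ)/√(1−η+4θ) + κ)²(1−η+2θ) ≤ 1` to the early-deficit margin `(1−η+2θ)·Zs⁻² ≤ Zs'⁻²`. [folklore] -/
theorem transfer {η θ κ l Zm Zs Zs' Zv : ℝ} (hη1 : η < 1) (hθ : 0 < θ) (hκ : 0 ≤ κ)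
    (hside : ((1 + κ) / Real.sqrt (1 - η + 4 * θ) + κ) ^ 2 * (1 - η + 2 * θ) ≤ 1)
    (hZm : 0 < Zm) (hZs : 0 < Zs) (hZs' : 0 < Zs') (hZv : 0 ≤ Zv) (hl : 0 < l)
    (h1 : Zv ^ 2 * (1 - η + 4 * θ) ≤ Zm ^ 2) (h2 : l * Zm ≤ (1 + κ) * Zs) (h3 : Zs' ≤ l * Zv + κ * Zs) :
    (1 - η + 2 * θ) * Zs⁻¹ ^ 2 ≤ Zs'⁻¹ ^ 2 := by
  set r : ℝ := Real.sqrt (1 - η + 4 * θ) with hr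
  have hq : 0 < 1 - η + 4 * θ := by linarith
  have hr0 : 0 < r := Real.sqrt_pos.2 hq
  have hr2 : r ^ 2 = 1 - η + 4 * θ := Real.sq_sqrt hq.le
  -- `Zv ≤ Zm / r`
  have hZv' : Zv * r ≤ Zm := by
    have h : (Zv * r) ^ 2 ≤ Zm ^ 2 := by rw [mul_pow, hr2]; exact h1
    exact (pow_le_pow_iff_left₀ (by positivity) hZm.le two_ne_zero).1 h
  -- `Zs' ≤ ((1+κ)/r + κ) Zs`
  have hb : Zs' ≤ ((1 + κ) / r + κ) * Zs := by
    have h4 : l * Zv ≤ (1 + κ) * Zs / r := by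
      rw [le_div_iff₀ hr0]
      calc l * Zv * r = l * (Zv * r) := by ring
        _ ≤ l * Zm := mul_le_mul_of_nonneg_left hZv' hl.le
        _ ≤ (1 + κ) * Zs := h2
    calc Zs' ≤ l * Zv + κ * Zs := h3
      _ ≤ (1 + κ) * Zs / r + κ * Zs := by linarith
      _ = ((1 + κ) / r + κ) * Zs := by ring
  have hB0 : 0 ≤ (1 + κ) / r + κ := by positivity
  have hsq : Zs' ^ 2 * (1 - η + 2 * θ) ≤ Zs ^ 2 := by
    have h5 : Zs' ^ 2 ≤ (((1 + κ) / r + κ) * Zs) ^ 2 := pow_le_pow_left₀ hZs'.le hb 2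
    have h6 : 0 < 1 - η + 2 * θ := by linarith
    calc Zs' ^ 2 * (1 - η + 2 * θ) ≤ (((1 + κ) / r + κ) * Zs) ^ 2 * (1 - η + 2 * θ) :=
          mul_le_mul_of_nonneg_right h5 h6.le
      _ = (((1 + κ) / r + κ) ^ 2 * (1 - η + 2 * θ)) * Zs ^ 2 := by ring
      _ ≤ 1 * Zs ^ 2 := mul_le_mul_of_nonneg_right hside (sq_nonneg _)
      _ = Zs ^ 2 := one_mul _
  -- invert
  have hZs2 : 0 < Zs ^ 2 := pow_pos hZs 2
  have hZs'2 : 0 < Zs' ^ 2 := pow_pos hZs' 2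
  rw [inv_pow, inv_pow, ← div_eq_mul_inv, div_le_iff₀ hZs2, ← div_eq_inv_mul, le_div_iff₀ hZs'2, mul_comm]
  exact hsq

/-! ## §3 `hED(m)` from (R-exit) + (R-shadow) -/

/-- **Reference deficit + orbit-uniform shadowing ⟹ the orbitwise uniform early deficit of `m`** (the `hED` block of
`rigidExit_of_orbitwiseEarlyDeficit` for one normalised maximiser `m` at `ν = 1`). [folklore] -/
theorem earlyDeficit_of_referenceShadowing {c : ℝ} (hsharp : (0 < c ∧ (∀ v : EuclideanSpace ℝ (Fin 3) → EuclideanSpace ℝ (Fin 3), (ContDiff ℝ (⊤ : ℕ∞) v ∧ Literature.Analysis.FluidPDE.VectorCalculus.IsDivFree v ∧ (∫⁻ x, ‖iteratedFDeriv ℝ 0 v x‖ₑ ^ 2 < ⊤) ∧ (∫⁻ x, ‖iteratedFDeriv ℝ 1 v x‖ₑ ^ 2 < ⊤) ∧ (∫⁻ x, ‖iteratedFDeriv ℝ 2 v x‖ₑ ^ 2 < ⊤)) → (∫ x, ⟪Literature.Analysis.FluidPDE.curl v x, fderiv ℝ v x (Literature.Analysis.FluidPDE.curl v x)⟫_ℝ)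 ≤ c * (∫ x, ‖Literature.Analysis.FluidPDE.curl v x‖ ^ 2) ^ (3 / 4 : ℝ) * (∫ x, Literature.Analysis.FluidPDE.frobeniusNormSq (fderiv ℝ (Literature.Analysis.FluidPDE.curl v) x)) ^ (3 / 4 : ℝ)) ∧ ∀ c' : ℝ, (∀ w : EuclideanSpace ℝ (Fin 3) → EuclideanSpace ℝ (Fin 3), (ContDiff ℝ (⊤ : ℕ∞) w ∧ Literature.Analysis.FluidPDE.VectorCalculus.IsDivFree w ∧ (∫⁻ x, ‖iteratedFDeriv ℝ 0 w x‖ₑ ^ 2 < ⊤) ∧ (∫⁻ x, ‖iteratedFDeriv ℝ 1 w x‖ₑ ^ 2 < ⊤) ∧ (∫⁻ x, ‖iteratedFDeriv ℝ 2 w x‖ₑ ^ 2 < ⊤)) → (∫ x, ⟪Literature.Analysis.FluidPDE.curl w x, fderiv ℝ w x (Literature.Analysis.FluidPDE.curl w x)⟫_ℝ) ≤ c' * (∫ x, ‖Literature.Analysis.FluidPDE.curl w x‖ ^ 2) ^ (3 / 4 : ℝ) * (∫ x, Literature.Analysis.FluidPDE.frobeniusNormSq (fderiv ℝ (Literature.Analysis.FluidPDE.curl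 w) x)) ^ (3 / 4 : ℝ)) → c ≤ c'))
    {m : EuclideanSpace ℝ (Fin 3) → EuclideanSpace ℝ (Fin 3)} (hm : ((ContDiff ℝ (⊤ : ℕ∞) m ∧ Literature.Analysis.FluidPDE.VectorCalculus.IsDivFree m ∧ (∫⁻ x, ‖iteratedFDeriv ℝ 0 m x‖ₑ ^ 2 < ⊤) ∧ (∫⁻ x, ‖iteratedFDeriv ℝ 1 m x‖ₑ ^ 2 < ⊤) ∧ (∫⁻ x, ‖iteratedFDeriv ℝ 2 m x‖ₑ ^ 2 < ⊤)) ∧ 0 < (∫ x, ‖Literature.Analysis.FluidPDE.curl m x‖ ^ 2) ∧ (∫ x, ⟪Literature.Analysis.FluidPDE.curl m x, fderiv ℝ m x (Literature.Analysis.FluidPDE.curl m x)⟫_ℝ) = c * (∫ x, ‖Literature.Analysis.FluidPDE.curl m x‖ ^ 2) ^ (3 / 4 : ℝ) * (∫ x, Literature.Analysis.FluidPDE.frobeniusNormSq (fderiv ℝ (Literature.Analysis.FluidPDE.curl m) x)) ^ (3 / 4 : ℝ) ∧ (∫ x, Literature.Analysis.FluidPDE.frobeniusNormSq (fderiv ℝ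 (Literature.Analysis.FluidPDE.curl m) x)) = 81 * c ^ 4 / (256 * 1 ^ 4) * (∫ x, ‖Literature.Analysis.FluidPDE.curl m x‖ ^ 2) ^ 3))
    {η θ κ ε : ℝ} {v : ℝ → EuclideanSpace ℝ (Fin 3) → EuclideanSpace ℝ (Fin 3)}
    (hη0 : 0 < η) (hη1 : η < 1) (hθ : 0 < θ) (hκ : 0 ≤ κ) (hε : 0 < ε)
    (hside : ((1 + κ) / Real.sqrt (1 - η + 4 * θ) + κ) ^ 2 * (1 - η + 2 * θ) ≤ 1) (h1 : (∫ x, ‖Literature.Analysis.FluidPDE.curl (v (η * (64 * 1 ^ 3 / (27 * c ^ 4) * (∫ x, ‖Literature.Analysis.FluidPDE.curl m x‖ ^ 2)⁻¹ ^ 2))) x‖ ^ 2) ^ 2 * (1 - η + 4 * θ) ≤ (∫ x, ‖Literature.Analysis.FluidPDE.curl m x‖ ^ 2) ^ 2) (h2 : (∀ T : ℝ, 0 < T → ∀ (u : ℝ → EuclideanSpace ℝ (Fin 3) → EuclideanSpace ℝ (Fin 3)) (p : ℝ → EuclideanSpace ℝ (Fin 3) → ℝ), Literature.Analysis.FluidPDE.IsMaximalSmoothSolution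 1 0 u p T → Literature.Analysis.FluidPDE.IsLerayHopfOn T 1 0 (u 0) u → Literature.Analysis.FluidPDE.HasRapidSpatialDecay (u 0) → ∀ s ∈ Set.Ioo 0 T, (∃ (a : EuclideanSpace ℝ (Fin 3)) (R : EuclideanSpace ℝ (Fin 3) ≃ₗᵢ[ℝ] EuclideanSpace ℝ (Fin 3)) (l : ℝ), 0 < l ∧ ((∫ x, ‖Literature.Analysis.FluidPDE.curl (u s - fun y => l • R (m (l • R.symm (y - a)))) x‖ ^ 2) ≤ ε ^ 2 * (∫ x, ‖Literature.Analysis.FluidPDE.curl (u s) x‖ ^ 2) ∧ (∫ x, Literature.Analysis.FluidPDE.frobeniusNormSq (fderiv ℝ (Literature.Analysis.FluidPDE.curl (u s - fun y => l • R (m (l • R.symm (y - a))))) x)) ≤ ε ^ 2 * (∫ x, Literature.Analysis.FluidPDE.frobeniusNormSq (fderiv ℝ (Literature.Analysis.FluidPDE.curl (u s)) x)))) → s + η * (64 * 1 ^ 3 / (27 * c ^ 4) * (∫ x, ‖Literature.Analysis.FluidPDE.curl (u s) x‖ ^ 2)⁻¹ ^ 2) < T → ∃ l : ℝ, 0 <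 l ∧ l * (∫ x, ‖Literature.Analysis.FluidPDE.curl m x‖ ^ 2) ≤ (1 + κ) * (∫ x, ‖Literature.Analysis.FluidPDE.curl (u s) x‖ ^ 2) ∧ (∫ x, ‖Literature.Analysis.FluidPDE.curl (u (s + η * (64 * 1 ^ 3 / (27 * c ^ 4) * (∫ x, ‖Literature.Analysis.FluidPDE.curl (u s) x‖ ^ 2)⁻¹ ^ 2))) x‖ ^ 2) ≤ l * (∫ x, ‖Literature.Analysis.FluidPDE.curl (v (η * (64 * 1 ^ 3 / (27 * c ^ 4) * (∫ x, ‖Literature.Analysis.FluidPDE.curl m x‖ ^ 2)⁻¹ ^ 2))) x‖ ^ 2) + κ * (∫ x, ‖Literature.Analysis.FluidPDE.curl (u s) x‖ ^ 2))) :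
    ∃ η θ ε : ℝ, 0 ≤ η ∧ η < 1 ∧ 0 < θ ∧ 0 < ε ∧ ∀ T : ℝ, 0 < T → ∀ (u : ℝ → EuclideanSpace ℝ (Fin 3) → EuclideanSpace ℝ (Fin 3)) (p : ℝ → EuclideanSpace ℝ (Fin 3) → ℝ), Literature.Analysis.FluidPDE.IsMaximalSmoothSolution 1 0 u p T → Literature.Analysis.FluidPDE.IsLerayHopfOn T 1 0 (u 0) u → Literature.Analysis.FluidPDE.HasRapidSpatialDecay (u 0) → ∀ s ∈ Set.Ioo 0 T, (∃ (a : EuclideanSpace ℝ (Fin 3)) (R : EuclideanSpace ℝ (Fin 3) ≃ₗᵢ[ℝ] EuclideanSpace ℝ (Fin 3)) (l : ℝ), 0 < l ∧ ((∫ x, ‖Literature.Analysis.FluidPDE.curl (u s - fun y => l • R (m (l • R.symm (y - a)))) x‖ ^ 2) ≤ ε ^ 2 * (∫ x, ‖Literature.Analysis.FluidPDE.curl (u s) x‖ ^ 2) ∧ (∫ x, Literature.Analysis.FluidPDE.frobeniusNormSq (fderiv ℝ (Literature.Analysis.FluidPDE.curl (u s - fun y => l • R (m (l • R.symm (y - a)))))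 x)) ≤ ε ^ 2 * (∫ x, Literature.Analysis.FluidPDE.frobeniusNormSq (fderiv ℝ (Literature.Analysis.FluidPDE.curl (u s)) x)))) → s + η * (64 * 1 ^ 3 / (27 * c ^ 4) * (∫ x, ‖Literature.Analysis.FluidPDE.curl (u s) x‖ ^ 2)⁻¹ ^ 2) < T ∧ (1 - η + 2 * θ) * (∫ x, ‖Literature.Analysis.FluidPDE.curl (u s) x‖ ^ 2)⁻¹ ^ 2 ≤ (∫ x, ‖Literature.Analysis.FluidPDE.curl (u (s + η * (64 * 1 ^ 3 / (27 * c ^ 4) * (∫ x, ‖Literature.Analysis.FluidPDE.curl (u s) x‖ ^ 2)⁻¹ ^ 2))) x‖ ^ 2)⁻¹ ^ 2 := by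
  have hc : 0 < c := hsharp.1
  have hZm : 0 < ∫ x, ‖curl m x‖ ^ 2 := hm.2.1
  refine ⟨η, θ, ε, hη0.le, hη1, hθ, hε, fun T hT u p hmax hLH hdec s hs hclose => ?_⟩
  have hwin := window_lt hsharp one_pos hT hmax hLH hdec hs hη0.le hη1
  refine ⟨hwin, ?_⟩
  obtain ⟨l, hl, hlZ, hsh⟩ := h2 T hT u p hmax hLH hdec s hs hclose hwin
  -- positivity of the class enstrophies
  obtain ⟨c₀, hsharp₀, hbud⟩ := efficiencyFloor_sharpLuDoeringBudget_proof
  obtain ⟨Zr, D, hZD⟩ := hbud 1 T one_pos hT u p hmax hLH hdec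
  have hZof : ∀ τ ∈ Ioo 0 T, (∫ x, ‖curl (u τ) x‖ ^ 2) = Zr τ := fun τ hτ => ((hZD τ hτ).2.2.2.1).symm
  have hpos : ∀ τ ∈ Ioo 0 T, 0 < ∫ x, ‖curl (u τ) x‖ ^ 2 := fun τ hτ => by
    have h1 := lintegral_curl_sq_pos one_pos hT hmax hLH hdec τ ⟨hτ.1.le, hτ.2⟩
    rw [(hZD τ hτ).1] at h1
    rw [hZof τ hτ]
    exact ENNReal.ofReal_pos.1 h1
  have hZs : 0 < ∫ x, ‖curl (u s) x‖ ^ 2 := hpos s hs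
  have hW0 : 0 ≤ η * (64 * 1 ^ 3 / (27 * c ^ 4) * (∫ x, ‖curl (u s) x‖ ^ 2)⁻¹ ^ 2) := by positivity
  have hs'I : s + η * (64 * 1 ^ 3 / (27 * c ^ 4) * (∫ x, ‖curl (u s) x‖ ^ 2)⁻¹ ^ 2) ∈ Ioo 0 T :=
    ⟨by linarith [hs.1], hwin⟩
  have hZs' := hpos _ hs'I
  have hZv : 0 ≤ ∫ x, ‖curl (v (η * (64 * 1 ^ 3 / (27 * c ^ 4) * (∫ x, ‖curl m x‖ ^ 2)⁻¹ ^ 2))) x‖ ^ 2 :=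
    integral_nonneg fun x => by positivity
  exact transfer hη1 hθ hκ hside hZm hZs hZs' hZv hl h1 hlZ hsh

/-- **`RigidExit` ⟸ (R-exit) + (R-shadow) for every normalised maximiser at `ν = 1`**, BY NAME against the route decl. The
hypothesis asks, for the sharp constant `c⋆` and each normalised maximiser `m` at viscosity `1`, for numbers `η ∈ (0,1)`, `θ > 0`,
`κ ≥ 0`, `ε > 0` with `((1+κ)/√(1−η+4θ) + κ)²(1−η+2θ) ≤ 1` and ONE function `v` (the reference flow from `m`) satisfying the
reference deficit (R-exit) and the orbit-uniform shadowing (R-shadow). [folklore] -/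
theorem rigidExit_of_referenceShadowing (H : ∀ c : ℝ, (0 < c ∧ (∀ v : EuclideanSpace ℝ (Fin 3) → EuclideanSpace ℝ (Fin 3), (ContDiff ℝ (⊤ : ℕ∞) v ∧ Literature.Analysis.FluidPDE.VectorCalculus.IsDivFree v ∧ (∫⁻ x, ‖iteratedFDeriv ℝ 0 v x‖ₑ ^ 2 < ⊤) ∧ (∫⁻ x, ‖iteratedFDeriv ℝ 1 v x‖ₑ ^ 2 < ⊤) ∧ (∫⁻ x, ‖iteratedFDeriv ℝ 2 v x‖ₑ ^ 2 < ⊤)) → (∫ x, ⟪Literature.Analysis.FluidPDE.curl v x, fderiv ℝ v x (Literature.Analysis.FluidPDE.curl v x)⟫_ℝ) ≤ c * (∫ x, ‖Literature.Analysis.FluidPDE.curl v x‖ ^ 2) ^ (3 / 4 : ℝ) * (∫ x, Literature.Analysis.FluidPDE.frobeniusNormSq (fderiv ℝ (Literature.Analysis.FluidPDE.curl v) x)) ^ (3 / 4 : ℝ)) ∧ ∀ c' : ℝ, (∀ w : EuclideanSpace ℝ (Fin 3) → EuclideanSpace ℝ (Fin 3), (ContDiff ℝ (⊤ : ℕ∞)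 w ∧ Literature.Analysis.FluidPDE.VectorCalculus.IsDivFree w ∧ (∫⁻ x, ‖iteratedFDeriv ℝ 0 w x‖ₑ ^ 2 < ⊤) ∧ (∫⁻ x, ‖iteratedFDeriv ℝ 1 w x‖ₑ ^ 2 < ⊤) ∧ (∫⁻ x, ‖iteratedFDeriv ℝ 2 w x‖ₑ ^ 2 < ⊤)) → (∫ x, ⟪Literature.Analysis.FluidPDE.curl w x, fderiv ℝ w x (Literature.Analysis.FluidPDE.curl w x)⟫_ℝ) ≤ c' * (∫ x, ‖Literature.Analysis.FluidPDE.curl w x‖ ^ 2) ^ (3 / 4 : ℝ) * (∫ x, Literature.Analysis.FluidPDE.frobeniusNormSq (fderiv ℝ (Literature.Analysis.FluidPDE.curl w) x)) ^ (3 / 4 : ℝ)) → c ≤ c') → ∀ m : EuclideanSpace ℝ (Fin 3) → EuclideanSpace ℝ (Fin 3), ((ContDiff ℝ (⊤ : ℕ∞) m ∧ Literature.Analysis.FluidPDE.VectorCalculus.IsDivFree m ∧ (∫⁻ x, ‖iteratedFDeriv ℝ 0 m x‖ₑ ^ 2 < ⊤) ∧ (∫⁻ x, ‖iteratedFDeriv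 ℝ 1 m x‖ₑ ^ 2 < ⊤) ∧ (∫⁻ x, ‖iteratedFDeriv ℝ 2 m x‖ₑ ^ 2 < ⊤)) ∧ 0 < (∫ x, ‖Literature.Analysis.FluidPDE.curl m x‖ ^ 2) ∧ (∫ x, ⟪Literature.Analysis.FluidPDE.curl m x, fderiv ℝ m x (Literature.Analysis.FluidPDE.curl m x)⟫_ℝ) = c * (∫ x, ‖Literature.Analysis.FluidPDE.curl m x‖ ^ 2) ^ (3 / 4 : ℝ) * (∫ x, Literature.Analysis.FluidPDE.frobeniusNormSq (fderiv ℝ (Literature.Analysis.FluidPDE.curl m) x)) ^ (3 / 4 : ℝ) ∧ (∫ x, Literature.Analysis.FluidPDE.frobeniusNormSq (fderiv ℝ (Literature.Analysis.FluidPDE.curl m) x)) = 81 * c ^ 4 / (256 * 1 ^ 4) * (∫ x, ‖Literature.Analysis.FluidPDE.curl m x‖ ^ 2) ^ 3) → ∃ (η θ κ ε : ℝ) (v : ℝ → EuclideanSpace ℝ (Fin 3) → EuclideanSpace ℝ (Fin 3)), 0 < η ∧ η < 1 ∧ 0 < θ ∧ 0 ≤ κ ∧ 0 < ε ∧ ((1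 + κ) / Real.sqrt (1 - η + 4 * θ) + κ) ^ 2 * (1 - η + 2 * θ) ≤ 1 ∧ (∫ x, ‖Literature.Analysis.FluidPDE.curl (v (η * (64 * 1 ^ 3 / (27 * c ^ 4) * (∫ x, ‖Literature.Analysis.FluidPDE.curl m x‖ ^ 2)⁻¹ ^ 2))) x‖ ^ 2) ^ 2 * (1 - η + 4 * θ) ≤ (∫ x, ‖Literature.Analysis.FluidPDE.curl m x‖ ^ 2) ^ 2 ∧ (∀ T : ℝ, 0 < T → ∀ (u : ℝ → EuclideanSpace ℝ (Fin 3) → EuclideanSpace ℝ (Fin 3)) (p : ℝ → EuclideanSpace ℝ (Fin 3) → ℝ), Literature.Analysis.FluidPDE.IsMaximalSmoothSolution 1 0 u p T → Literature.Analysis.FluidPDE.IsLerayHopfOn T 1 0 (u 0) u → Literature.Analysis.FluidPDE.HasRapidSpatialDecay (u 0) → ∀ s ∈ Set.Ioo 0 T, (∃ (a : EuclideanSpace ℝ (Fin 3)) (R : EuclideanSpace ℝ (Fin 3) ≃ₗᵢ[ℝ] EuclideanSpace ℝ (Fin 3)) (l : ℝ), 0 < l ∧ ((∫ x, ‖Literature.Analysis.FluidPDE.curl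 (u s - fun y => l • R (m (l • R.symm (y - a)))) x‖ ^ 2) ≤ ε ^ 2 * (∫ x, ‖Literature.Analysis.FluidPDE.curl (u s) x‖ ^ 2) ∧ (∫ x, Literature.Analysis.FluidPDE.frobeniusNormSq (fderiv ℝ (Literature.Analysis.FluidPDE.curl (u s - fun y => l • R (m (l • R.symm (y - a))))) x)) ≤ ε ^ 2 * (∫ x, Literature.Analysis.FluidPDE.frobeniusNormSq (fderiv ℝ (Literature.Analysis.FluidPDE.curl (u s)) x)))) → s + η * (64 * 1 ^ 3 / (27 * c ^ 4) * (∫ x, ‖Literature.Analysis.FluidPDE.curl (u s) x‖ ^ 2)⁻¹ ^ 2) < T → ∃ l : ℝ, 0 < l ∧ l * (∫ x, ‖Literature.Analysis.FluidPDE.curl m x‖ ^ 2) ≤ (1 + κ) * (∫ x, ‖Literature.Analysis.FluidPDE.curl (u s) x‖ ^ 2) ∧ (∫ x, ‖Literature.Analysis.FluidPDE.curl (u (s + η * (64 * 1 ^ 3 / (27 * c ^ 4) * (∫ x, ‖Literature.Analysis.FluidPDE.curl (u s) x‖ ^ 2)⁻¹ ^ 2))) x‖ ^ 2) ≤ l *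 (∫ x, ‖Literature.Analysis.FluidPDE.curl (v (η * (64 * 1 ^ 3 / (27 * c ^ 4) * (∫ x, ‖Literature.Analysis.FluidPDE.curl m x‖ ^ 2)⁻¹ ^ 2))) x‖ ^ 2) + κ * (∫ x, ‖Literature.Analysis.FluidPDE.curl (u s) x‖ ^ 2))) :
    Summit.NavierStokesRegularity.NavierStokesRegularity.Theses.EfficiencyFloor.RigidExit :=
  rigidExit_of_orbitwiseEarlyDeficit fun c hsharp m hm => by
    obtain ⟨η, θ, κ, ε, v, hη0, hη1, hθ, hκ, hε, hside, h1, h2⟩ := H c hsharp m hm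
    exact earlyDeficit_of_referenceShadowing hsharp hm hη0 hη1 hθ hκ hε hside h1 h2

/-! ## §4 The form in which the residue is to be used: under `MaximiserSetRigidity` -/

/-- **`RigidExit` ⟸ (`MaximiserSetRigidity` → (R-exit)+(R-shadow))**, BY NAME. Since `RigidExit` IS the implication
`MaximiserSetRigidity → NearMaximiserBoundedAmplification`, the two residual statements need only be proved UNDER clauses (a)+(b)
of `MaximiserSetRigidity` — which is where (R-exit) (instant exit of the reference flow: finitely many maximiser orbits, none a
relative equilibrium) gets its force. This is the door future hands should use. [folklore] -/
theorem rigidExit_of_referenceShadowing_of_maximiserSetRigidity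
    (HH : Summit.NavierStokesRegularity.NavierStokesRegularity.Theses.EfficiencyFloor.MaximiserSetRigidity →
      ∀ c : ℝ, (0 < c ∧ (∀ v : EuclideanSpace ℝ (Fin 3) → EuclideanSpace ℝ (Fin 3), (ContDiff ℝ (⊤ : ℕ∞) v ∧ Literature.Analysis.FluidPDE.VectorCalculus.IsDivFree v ∧ (∫⁻ x, ‖iteratedFDeriv ℝ 0 v x‖ₑ ^ 2 < ⊤) ∧ (∫⁻ x, ‖iteratedFDeriv ℝ 1 v x‖ₑ ^ 2 < ⊤) ∧ (∫⁻ x, ‖iteratedFDeriv ℝ 2 v x‖ₑ ^ 2 < ⊤)) → (∫ x, ⟪Literature.Analysis.FluidPDE.curl v x, fderiv ℝ v x (Literature.Analysis.FluidPDE.curl v x)⟫_ℝ) ≤ c * (∫ x, ‖Literature.Analysis.FluidPDE.curl v x‖ ^ 2) ^ (3 / 4 : ℝ) * (∫ x, Literature.Analysis.FluidPDE.frobeniusNormSq (fderiv ℝ (Literature.Analysis.FluidPDE.curl v) x)) ^ (3 / 4 : ℝ)) ∧ ∀ c' : ℝ, (∀ w : EuclideanSpace ℝ (Fin 3) → EuclideanSpace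 ℝ (Fin 3), (ContDiff ℝ (⊤ : ℕ∞) w ∧ Literature.Analysis.FluidPDE.VectorCalculus.IsDivFree w ∧ (∫⁻ x, ‖iteratedFDeriv ℝ 0 w x‖ₑ ^ 2 < ⊤) ∧ (∫⁻ x, ‖iteratedFDeriv ℝ 1 w x‖ₑ ^ 2 < ⊤) ∧ (∫⁻ x, ‖iteratedFDeriv ℝ 2 w x‖ₑ ^ 2 < ⊤)) → (∫ x, ⟪Literature.Analysis.FluidPDE.curl w x, fderiv ℝ w x (Literature.Analysis.FluidPDE.curl w x)⟫_ℝ) ≤ c' * (∫ x, ‖Literature.Analysis.FluidPDE.curl w x‖ ^ 2) ^ (3 / 4 : ℝ) * (∫ x, Literature.Analysis.FluidPDE.frobeniusNormSq (fderiv ℝ (Literature.Analysis.FluidPDE.curl w) x)) ^ (3 / 4 : ℝ)) → c ≤ c') → ∀ m : EuclideanSpace ℝ (Fin 3) → EuclideanSpace ℝ (Fin 3), ((ContDiff ℝ (⊤ : ℕ∞) m ∧ Literature.Analysis.FluidPDE.VectorCalculus.IsDivFree m ∧ (∫⁻ x, ‖iteratedFDeriv ℝ 0 m x‖ₑ ^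 2 < ⊤) ∧ (∫⁻ x, ‖iteratedFDeriv ℝ 1 m x‖ₑ ^ 2 < ⊤) ∧ (∫⁻ x, ‖iteratedFDeriv ℝ 2 m x‖ₑ ^ 2 < ⊤)) ∧ 0 < (∫ x, ‖Literature.Analysis.FluidPDE.curl m x‖ ^ 2) ∧ (∫ x, ⟪Literature.Analysis.FluidPDE.curl m x, fderiv ℝ m x (Literature.Analysis.FluidPDE.curl m x)⟫_ℝ) = c * (∫ x, ‖Literature.Analysis.FluidPDE.curl m x‖ ^ 2) ^ (3 / 4 : ℝ) * (∫ x, Literature.Analysis.FluidPDE.frobeniusNormSq (fderiv ℝ (Literature.Analysis.FluidPDE.curl m) x)) ^ (3 / 4 : ℝ) ∧ (∫ x, Literature.Analysis.FluidPDE.frobeniusNormSq (fderiv ℝ (Literature.Analysis.FluidPDE.curl m) x)) = 81 * c ^ 4 / (256 * 1 ^ 4) * (∫ x, ‖Literature.Analysis.FluidPDE.curl m x‖ ^ 2) ^ 3) → ∃ (η θ κ ε : ℝ) (v : ℝ → EuclideanSpace ℝ (Fin 3) → EuclideanSpace ℝ (Fin 3)), 0 < η ∧ η < 1 ∧ 0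 < θ ∧ 0 ≤ κ ∧ 0 < ε ∧ ((1 + κ) / Real.sqrt (1 - η + 4 * θ) + κ) ^ 2 * (1 - η + 2 * θ) ≤ 1 ∧ (∫ x, ‖Literature.Analysis.FluidPDE.curl (v (η * (64 * 1 ^ 3 / (27 * c ^ 4) * (∫ x, ‖Literature.Analysis.FluidPDE.curl m x‖ ^ 2)⁻¹ ^ 2))) x‖ ^ 2) ^ 2 * (1 - η + 4 * θ) ≤ (∫ x, ‖Literature.Analysis.FluidPDE.curl m x‖ ^ 2) ^ 2 ∧ (∀ T : ℝ, 0 < T → ∀ (u : ℝ → EuclideanSpace ℝ (Fin 3) → EuclideanSpace ℝ (Fin 3)) (p : ℝ → EuclideanSpace ℝ (Fin 3) → ℝ), Literature.Analysis.FluidPDE.IsMaximalSmoothSolution 1 0 u p T → Literature.Analysis.FluidPDE.IsLerayHopfOn T 1 0 (u 0) u → Literature.Analysis.FluidPDE.HasRapidSpatialDecay (u 0) → ∀ s ∈ Set.Ioo 0 T, (∃ (a : EuclideanSpace ℝ (Fin 3)) (R : EuclideanSpace ℝ (Fin 3) ≃ₗᵢ[ℝ] EuclideanSpace ℝ (Fin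 3)) (l : ℝ), 0 < l ∧ ((∫ x, ‖Literature.Analysis.FluidPDE.curl (u s - fun y => l • R (m (l • R.symm (y - a)))) x‖ ^ 2) ≤ ε ^ 2 * (∫ x, ‖Literature.Analysis.FluidPDE.curl (u s) x‖ ^ 2) ∧ (∫ x, Literature.Analysis.FluidPDE.frobeniusNormSq (fderiv ℝ (Literature.Analysis.FluidPDE.curl (u s - fun y => l • R (m (l • R.symm (y - a))))) x)) ≤ ε ^ 2 * (∫ x, Literature.Analysis.FluidPDE.frobeniusNormSq (fderiv ℝ (Literature.Analysis.FluidPDE.curl (u s)) x)))) → s + η * (64 * 1 ^ 3 / (27 * c ^ 4) * (∫ x, ‖Literature.Analysis.FluidPDE.curl (u s) x‖ ^ 2)⁻¹ ^ 2) < T → ∃ l : ℝ, 0 < l ∧ l * (∫ x, ‖Literature.Analysis.FluidPDE.curl m x‖ ^ 2) ≤ (1 + κ) * (∫ x, ‖Literature.Analysis.FluidPDE.curl (u s) x‖ ^ 2) ∧ (∫ x, ‖Literature.Analysis.FluidPDE.curl (u (s + η * (64 * 1 ^ 3 / (27 * c ^ 4) * (∫ x, ‖Literature.Analysis.FluidPDE.curl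 (u s) x‖ ^ 2)⁻¹ ^ 2))) x‖ ^ 2) ≤ l * (∫ x, ‖Literature.Analysis.FluidPDE.curl (v (η * (64 * 1 ^ 3 / (27 * c ^ 4) * (∫ x, ‖Literature.Analysis.FluidPDE.curl m x‖ ^ 2)⁻¹ ^ 2))) x‖ ^ 2) + κ * (∫ x, ‖Literature.Analysis.FluidPDE.curl (u s) x‖ ^ 2))) :
    Summit.NavierStokesRegularity.NavierStokesRegularity.Theses.EfficiencyFloor.RigidExit := by
  unfold Summit.NavierStokesRegularity.NavierStokesRegularity.Theses.EfficiencyFloor.RigidExit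
  intro hMSR
  have h : Summit.NavierStokesRegularity.NavierStokesRegularity.Theses.EfficiencyFloor.MaximiserSetRigidity →
      Summit.NavierStokesRegularity.NavierStokesRegularity.Theses.EfficiencyFloor.NearMaximiserBoundedAmplification :=
    rigidExit_of_referenceShadowing (HH hMSR)
  exact h hMSR

end ReferenceShadowing

end RigidExit

end Summit.NavierStokesRegularity.NavierStokesRegularity.Theorems

end
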